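import Mathlib
import Summits.Ventures.PercRepro.TriangleCapThreeTrianglesE

/-!
# PercRepro — SIX ORDERED TRIANGLES PER TRIANGLE: `6 |F| ≤ |T₃|` FOR A FAMILY `F` OF TRIANGLES (p3, gen 37; part 66)

Every triangle `{a, b, c}` of `D` carries the six ordered triangles `((a, b), c), …`; grouping the ordered triangles
by their vertex set (`card_eq_sum_card_fiberwise`), a family `F` of distinct triangles gives
**`six_mul_card_le_card_triangles3`**: `6 |F| ≤ |T₃|`.  Hence **`stability_two_of_four_triangles`**: four distinct
triangles pay the `r = 2` cell for every `k ≥ 9` (the envelope `6 Σ d² + (k − 6) |T₃| ≤ 6mk` with `|T₃| ≥ 24`).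
Axioms: standard.
-/

namespace PercRepro

namespace TriangleCap

namespace C047

open Finset

variable {V : Type*} [Fintype V] [DecidableEq V]

/-- The vertex set of an ordered triangle. -/
def vset (t : (V × V) × V) : Finset V := {t.1.1, t.1.2, t.2}

omit [Fintype V] in
/-- `{a, b, c}` as an insert-chain is invariant under the six permutations. -/
theorem triple_perm {a b c : V} :
    ({b, c, a} : Finset V) = {a, b, c} ∧ ({c, a, b} : Finset V) = {a, b, c} ∧
    ({b, a, c} : Finset V) = {a, b, c} ∧ ({a, c, b} : Finset V) = {a, b, c} ∧
    ({c, b, a} : Finset V) = {a, b, c} := by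
  refine ⟨?_, ?_, ?_, ?_, ?_⟩ <;> ext x <;> simp only [mem_insert, mem_singleton] <;> tauto

/-- A triangle `{a, b, c}` carries at least six ordered triangles with that vertex set. -/
theorem six_le_card_fiber (D : SimpleGraph V) [DecidableRel D.Adj] {a b c : V} (hab : D.Adj a b)
    (hac : D.Adj a c) (hbc : D.Adj b c) :
    6 ≤ ((triangles3 D).filter (fun t => vset t = {a, b, c})).card := by
  have hab' := hab.ne
  have hac' := hac.ne
  have hbc' := hbc.ne
  obtain ⟨p1, p2, p3, p4, p5⟩ := (triple_perm (a := a) (b := b) (c := c))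
  have hsub : ({((a, b), c), ((b, c), a), ((c, a), b), ((b, a), c), ((a, c), b), ((c, b), a)} :
      Finset ((V × V) × V)) ⊆ (triangles3 D).filter (fun t => vset t = {a, b, c}) := by
    intro t ht
    simp only [mem_insert, mem_singleton] at ht
    rw [mem_filter, mem_triangles3]
    rcases ht with rfl | rfl | rfl | rfl | rfl | rfl
    · exact ⟨⟨hab, hac, hbc⟩, rfl⟩
    · exact ⟨⟨hbc, hab.symm, hac.symm⟩, p1⟩
    · exact ⟨⟨hac.symm, hbc.symm, hab⟩, p2⟩
    · exact ⟨⟨hab.symm, hbc, hac⟩, p3⟩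
    · exact ⟨⟨hac, hab, hbc.symm⟩, p4⟩
    · exact ⟨⟨hbc.symm, hac.symm, hab.symm⟩, p5⟩
  refine le_trans ?_ (card_le_card hsub)
  rw [card_insert_of_notMem, card_insert_of_notMem, card_insert_of_notMem, card_insert_of_notMem,
    card_insert_of_notMem, card_singleton]
  all_goals simp [hab', hac', hbc', hab'.symm, hac'.symm, hbc'.symm]

/-- **SIX ORDERED TRIANGLES PER TRIANGLE:** for a family `F` of vertex sets of triangles, `6 |F| ≤ |T₃|`. -/
theorem six_mul_card_le_card_triangles3 (D : SimpleGraph V) [DecidableRel D.Adj] (F : Finset (Finset V))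
    (hF : ∀ T ∈ F, ∃ a b c, D.Adj a b ∧ D.Adj a c ∧ D.Adj b c ∧ T = {a, b, c}) :
    6 * F.card ≤ (triangles3 D).card := by
  set s := (triangles3 D).filter (fun t => vset t ∈ F) with hs
  have h1 : s.card ≤ (triangles3 D).card := card_le_card (filter_subset _ _)
  have h2 : s.card = ∑ T ∈ F, (s.filter (fun t => vset t = T)).card := by
    apply card_eq_sum_card_fiberwise
    intro t ht
    rw [hs, mem_coe, mem_filter] at ht
    exact ht.2
  have h3 : ∀ T ∈ F, 6 ≤ (s.filter (fun t => vset t = T)).card := by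
    intro T hT
    obtain ⟨a, b, c, hab, hac, hbc, rfl⟩ := hF T hT
    have e : s.filter (fun t => vset t = {a, b, c}) = (triangles3 D).filter (fun t => vset t = {a, b, c}) := by
      rw [hs, filter_filter]
      apply filter_congr
      intro t _
      constructor
      · exact fun h => h.2
      · exact fun h => ⟨h ▸ hT, h⟩
    rw [e]
    exact six_le_card_fiber D hab hac hbc
  have h4 : ∑ _T ∈ F, 6 ≤ ∑ T ∈ F, (s.filter (fun t => vset t = T)).card := sum_le_sum h3
  rw [sum_const, smul_eq_mul] at h4
  omega

/-- **FOUR DISTINCT TRIANGLES PAY THE `r = 2` CELL FOR `k ≥ 9`:** `|T₃| ≥ 24` and the envelope. -/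
theorem stability_two_of_twentyfour (D : SimpleGraph V) [DecidableRel D.Adj] (hK : K4mFree D)
    (hk : 9 ≤ Fintype.card V) (hT : 24 ≤ (triangles3 D).card) :
    ∑ v, deg D v * deg D v + 2 * (Fintype.card V - 3) ≤ D.edgeFinset.card * Fintype.card V := by
  have h := stability_of_triangles D hK (by omega) 4 2 (by omega) (by
    obtain ⟨k', hk'⟩ : ∃ k', Fintype.card V = k' + 9 := ⟨Fintype.card V - 9, by omega⟩
    rw [hk']
    have e1 : k' + 9 - 2 - 1 = k' + 6 := by omega
    have e2 : k' + 9 - 6 = k' + 3 := by omega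
    rw [e1, e2]
    omega)
  have e : Fintype.card V - 2 - 1 = Fintype.card V - 3 := by omega
  rw [e] at h
  exact h

end C047

end TriangleCap

end PercRepro
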